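import Summits.QuantumFields.BalabanUV.Beta.EriceFlowEnclosureB12AsPrintedUpper
import Summits.QuantumFields.BalabanUV.Beta.EriceFlowEnclosureB12AsPrintedMarginal
import Summits.QuantumFields.BalabanUV.Beta.EriceZetaUniformBound

/-!
# Beta / EriceFlowEnclosureB12AsPrintedWitness — consistency and independence witnesses for the as-printed interface of [I]:
# `B12BetaAsPrinted` is consistent WITH Theorem 2 + asymptotic freedom (an AF toy) and WITHOUT Theorem 2 (the zero toy), so Theorem 2
# is independent of [I]'s printed content as typed (β-flow team, prover 1, unit `b2b-balaban-beta-bflow-p1`, gen 32; ROW AP-I;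
# companions `…B12AsPrintedUpper` (the junctions used here), `…B12AsPrintedMarginal` ∕ `…B12AsPrintedOrientation` (orientation audit))

HONEST FRAMING (page 1 of everything the β sub-cell writes): discharging `BetaPertH` makes Bałaban's UV stability UNCONDITIONAL — a
real constructive-QFT result; it is NOT the continuum limit and NOT the Clay problem.  HONEST DEPENDENCY (cell reorg 2026-08-19,
verbatim): «continuum YM on T⁴ ⇐ BetaPertH ∧ nine spine estimates (0/9 proved); BetaPertH ⇐ (D1) ∧ (D4) ∧ CAP+tail; G-an2-4 gates
asym, D1 and NE2/3/4.»  THIS MODULE DISCHARGES NOTHING: it builds two TOY settings of the statement-exact typing of [I] = T. Bałaban,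
Commun. Math. Phys. **109** (1987) [Balaban1987RG1] (`B12BetaAsPrinted`, typer unit `b2b-balaban-beta-asprinted`, p537882 ✓ ∕ v1.1
p539116 ✓) INSIDE EXISTENCE PROOFS (def-free), to certify what the typed predicate does and does not decide.  The toys are OURS
([folklore] objects: a constant β, the marginal kernel of the tree, forward runs of (0.20)); nothing of Bałaban's β_{j+1}, Π_{j+1} or of
[I]'s claims is asserted; no toy is claimed to resemble the construction.

WHAT THIS FILE PROVES (0 sorry, 0 def):
§1 `not_theorem2Statement_of_constRuns` (a setting whose runs are constant violates `Theorem2Statement`: at K = 1 the printed lower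
   inequality of (0.31) would give β·ln L ≤ 0); `zeroToy_exists` (L = 13, β ≡ 0, all kernels 0, constant runs: `StandingHypotheses ∧
   Definitions ∧ Conclusions` — the typer's NOT-TO-FILE consistency probe re-built def-free); **`asPrinted_consistent_with_not_theorem2`**
   (∃ S, StandingHypotheses ∧ Definitions ∧ Conclusions ∧ B12BetaAsPrinted ∧ ¬Theorem2Statement).
§2 THE TRANSPOSED MARGINAL KERNEL `x ↦ c·Re Q_{νμ}(x)` AS A REAL B12 KERNEL (PART 1's orientation — the one `d121` accepts): realness
   (`wilsonQ_im`, `wilsonQ_re_coe`); **`secondMoment_toyKernel`** ((1.22) right member = c, μ ≠ ν; `B12Rep537.tsum_wilsonQ_mul_coord2`);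
   `decay510_toyKernel` ((5.10), C = |c|·MQ(1, d), δ₁ = 1); **`fourier_toyKernel`** ((1.22) left member = c;
   `BJ86EffectiveAction.neg_mixedDeriv0_fourierT_eq_secondMoment` + `EriceZetaUniformBound`'s summabilities); `reflect_toyKernel` (typed (5.7)).
§3 `diffOp_smul` ∕ `diffWord_smul` ∕ `diffWord_zero` ∕ `diffWord_word`; **`rep537_toyKernel`** ((5.37)∕(5.38) with (5.44), μ ≠ ν:
   `c·Q_{νμ} − c·wilsonQ μ ν = Σ_w D_w Π′_w`, Π′ supported on the two third-order words (Δ*_μ, Δ_ν, Δ*_ν) ↦ −c·δ₀, (Δ*_ν, Δ_μ, Δ*_μ) ↦ +c·δ₀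
   — PART 1's `crossQ_sub_transpose` — each Π′_w exponentially bounded at any rate with constant |c|).
§4 `natRec_run_succ` ∕ `natRec_run_step` (the forward solution of (0.20) with β ≡ b, def-free, IS the printed forward determination
   `d020`); **`afToy_exists`** (L = 13, β ≡ 1∕100, Π_{j+1} := (1∕100)·Re Qᵀ, pol F := F(1)·(1∕100)·Re Qᵀ, log Z ≡ 1, 𝐄_int ≡ 0, (1.18)-slot
   «|F(1)| ≤ E», E₀ = δ₁ = 1: `StandingHypotheses ∧ Definitions ∧ Conclusions ∧ RunHyp S (1, 0, 1∕2)`);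
   **`asPrinted_consistent_with_theorem2_and_AF`** (∃ S hH, Definitions ∧ Conclusions ∧ B12BetaAsPrinted ∧ (∃ b > 0, β ≡ b ∧ BetaLowerH b ∧
   BetaUpperH b ∧ BetaContH) ∧ (∃ P, RunHyp S P ∧ 1 ≤ K) ∧ Theorem2Statement S, via `…B12AsPrintedUpper.theorem2Statement_of_letters`:
   THE TYPED [I] INTERFACE HAS NO SIGN CLASH WITH β > 0 — contrast the Erice interface's orientation note `beta/asprinted/DELTA.md` D-23
   — AND THE TYPED PAIR (`d121`, `c537`) IS JOINTLY SATISFIABLE WITH β ≠ 0: PART 2's orientation mismatch is not an inconsistency);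
   **`theorem2_independent_of_asPrinted`** (neither `… → Theorem2Statement` nor `… → ¬Theorem2Statement` holds for all settings with
   StandingHypotheses ∧ Definitions ∧ Conclusions: what [I]+[II] prove does not decide the Theorem 2 that [I] states without proof).
NOT CLAIMED: that either toy resembles Bałaban's objects; any interface field for the construction; `BetaPertH`; continuum; Clay.
-/

namespace Summit.QuantumFields.BalabanUV.Beta.EriceFlowEnclosureB12AsPrintedWitness

open Literature.MathematicalPhysics.QuantumFieldTheory.GawedzkiKupiainen1985.PeriodicGleason (Pt delta unitVec ExpBound wt wt_pos)
open Literature.MathematicalPhysics.QuantumFieldTheory.Balaban1983to89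
open Literature.MathematicalPhysics.QuantumFieldTheory.Balaban1983to89.B12Rep537 (wilsonQ crossQ dirac fdelta crossQ_apply
  MQ wilsonQ_bound expBound_dirac kron tsum_wilsonQ_mul_coord2)
open Literature.MathematicalPhysics.QuantumFieldTheory.Balaban1983to89.B12BetaAsPrinted
open Literature.MathematicalPhysics.QuantumFieldTheory.BalabanJaffe1986.BJ86EffectiveAction (fourierT mixedDeriv0
  neg_mixedDeriv0_fourierT_eq_secondMoment)
open Literature.MathematicalPhysics.QuantumFieldTheory.Balaban1983to89.FlowStep (prefixOf Box BetaContH BetaLowerH BetaUpperH)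
open Summit.QuantumFields.BalabanUV.Beta.EriceFlowEnclosureB12AsPrintedMarginal
open Summit.QuantumFields.BalabanUV.Beta.EriceFlowEnclosureB12AsPrintedUpper
open Summit.QuantumFields.BalabanUV.Beta.EriceZetaUniformBound (summable_abs_of_decay510 summable_abs_mul_coord_of_decay510
  summable_abs_mul_coord_coord_of_decay510)

noncomputable section

/-! ## §1 No running, no Theorem 2: constant runs defeat (0.31) -/

/-- **A setting whose runs do not run violates Theorem 2 as printed.**  If every run is constant (`g_k = g₀` — what (0.20) produces
when β ≡ 0 along the runs), then `Theorem2Statement S hL` FAILS: at K = 1 the printed lower inequality of (0.31) would force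
`β·ln L ≤ 0` with β > 0, L > 1. [cite: Balaban1987RG1, Thm 2 (0.31) p.259] -/
theorem not_theorem2Statement_of_constRuns {S : Setting} (hcpl : ∀ P k, S.cpl P k = P.g0) {hL : Odd S.L ∧ 1 < S.L} :
    ¬ Theorem2Statement S hL := by
  intro h
  obtain ⟨γ₀, hγ₀, hγ⟩ := tunedRuns_of_theorem2Statement h 0
  obtain ⟨g₁, hg₁, hg⟩ := hγ γ₀ hγ₀ le_rfl
  obtain ⟨β, β', hβ, -, hK⟩ := hg g₁ hg₁ le_rfl
  obtain ⟨g₀, -, hend, hD⟩ := hK 1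
  have h0 := (hD 0 (Nat.zero_le 1)).1
  rw [hcpl] at h0 hend
  have hlog : 0 < Real.log (S.L : ℝ) := Real.log_pos (by exact_mod_cast hL.2)
  have hend' : g₀ = g₁ := hend
  simp only [Nat.cast_one, Nat.cast_zero, sub_zero, mul_one] at h0
  rw [hend'] at h0
  linarith [mul_pos hβ hlog]

/-- **THE ZERO TOY**: a setting with L = 13, β ≡ 0, all kernels 0, constant runs, satisfying `StandingHypotheses ∧ Definitions ∧
Conclusions` — the typer's NOT-TO-FILE consistency probe of the interface, re-built def-free. [folklore] -/
theorem zeroToy_exists : ∃ S : Setting, (∀ P k, S.cpl P k = P.g0) ∧ (∀ j p, S.β j p = 0) ∧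
    StandingHypotheses S ∧ Definitions S ∧ Conclusions S := by
  -- `Setting` fields in order: L, groupScope, ε₀, cpl, β, γ, M, κ, Cfg, one, logZ, Eint, Ebold, repr437, α₀, α₁, E₀, Mκ, pol, polIV, κ₀,
  -- indAss, ε₁, altCutoff266, logN2, δ₀, δ₁, C510, C544 (anonymous constructor).
  refine ⟨⟨13, True, 1, fun P _ => P.g0, fun _ _ => 0, 1, 1, 1, fun _ => Unit, fun _ => (), fun _ _ => 0, fun _ _ _ => 0,
      fun _ _ _ => 0, fun _ _ _ => True, 1, 1, 0, fun _ => 1, fun _ _ => fun _ _ _ => 0, fun _ _ => fun _ _ _ => 0, 1,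
      fun _ _ => True, 1, True, fun _ _ => 0, 1, 1, 0, 0⟩,
    fun _ _ => rfl, fun _ _ => rfl, ?_, ?_, ?_⟩
  · exact { hL := ⟨by decide, by norm_num⟩, hG := trivial, hκ₀ := by norm_num, hMκ := by norm_num, hγ := by norm_num,
            hε₀ := by norm_num, hε₁ := by norm_num, hα₀ := by norm_num, hα₁ := by norm_num, hκ := by norm_num,
            hM := by norm_num }
  · refine { d018 := fun P => rfl, d020 := ?_, d13 := ?_, d213 := ?_, d214 := ?_, d120 := ?_, d120split := ?_,
             d121 := ?_, d122 := ?_ }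
    · intro P k _ hpos _; exact ⟨hpos 0 (Nat.zero_le _), by simp⟩
    · intro j p U; simp
    · intro k p p' _ _; rfl
    · intro k p; rfl
    · intro j p; rfl
    · intro j p; funext μ ν x; simp
    · intro j p
      refine ⟨fun σ μ ν x => rfl, fun ε _ μ ν z => by simp, fun μ ν z => rfl⟩
    · intro j p _ μ ν _
      exact ⟨by simp [mixedDeriv0, fourierT], by simp [B12Beta.secondMoment]⟩
  · refine { c13 := fun _ _ _ _ => trivial, c118 := fun _ _ _ _ _ _ => ⟨trivial, trivial⟩, c264 := ?_, c510 := ?_,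
             c537 := ?_ }
    · intro P _ j _
      refine ⟨fun n => ?_, fun _ => ?_, fun n => ⟨0, fun s _ => ?_⟩⟩
      · show ContDiffOn ℝ n (fun _ : ℝ => (0 : ℝ)) _; exact contDiffOn_const
      · show AnalyticOn ℝ (fun _ : ℝ => (0 : ℝ)) _; exact analyticOn_const
      · show ‖iteratedDerivWithin n (fun _ : ℝ => (0 : ℝ)) _ s‖ ≤ 0
        rw [iteratedDerivWithin_const]; split_ifs <;> simp
    · exact ⟨by norm_num, fun j F E _ μ ν x => by simp⟩
    · intro P _ j _ s _ μ ν
      refine ⟨fun _ _ => 0, fun x => ?_, fun w n => by simp⟩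
      have h0 : ∀ w : Fin 3 → Fin 4 × Bool, diffWord w (fun _ : Pt 4 => (0 : ℂ)) x = 0 := by
        intro w
        have hop : ∀ a : Fin 4 × Bool, diffOp a (fun _ : Pt 4 => (0 : ℂ)) = fun _ => 0 := by
          intro a; funext y; unfold diffOp; cases a.2 <;> simp [delta, B12Rep537.fdelta]
        simp [diffWord, hop]
      simp [h0]

/-- **[I] AS PRINTED IS CONSISTENT WITH THE NEGATION OF ITS THEOREM 2** (as typed): there is a setting satisfying p. 251's ∕ Theorem 3's
standing hypotheses, the printed definitions and Theorem 3's printed conclusions — hence `B12BetaAsPrinted S` — for which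
`Theorem2Statement S hL` is FALSE (the zero toy: β ≡ 0, no running).  So the typed content of [I]+[II] does NOT imply Theorem 2.
[cite: Balaban1987RG1, Thm 2 p.259 («A proof … will be given in a separate paper») with Thm 3 p.264] -/
theorem asPrinted_consistent_with_not_theorem2 :
    ∃ S : Setting, ∃ hH : StandingHypotheses S,
      Definitions S ∧ Conclusions S ∧ B12BetaAsPrinted S ∧ ¬ Theorem2Statement S (hL_of_standing hH) := by
  obtain ⟨S, hcpl, -, hH, hD, hC⟩ := zeroToy_exists
  exact ⟨S, hH, hD, hC, fun _ _ => hC, not_theorem2Statement_of_constRuns hcpl⟩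

/-! ## §2 The transposed marginal kernel as a real B12 kernel: realness, second moment, decay, (1.22) both members, symmetries -/

variable {d : ℕ}

/-- `δ₀` is real-valued. [folklore] -/
theorem dirac_im (y : Pt d) : (dirac y).im = 0 := by unfold dirac; split_ifs <;> simp

/-- The cross kernels are real-valued. [folklore] -/
theorem crossQ_im (μ ν : Fin d) (x : Pt d) : (crossQ μ ν x).im = 0 := by rw [crossQ_apply]; simp [dirac_im]

/-- The marginal kernel is real-valued. [cite: Balaban1987RG1, (5.36)–(5.37) p.297] -/
theorem wilsonQ_im (μ ν : Fin d) (x : Pt d) : (wilsonQ μ ν x).im = 0 := by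
  unfold wilsonQ; split_ifs <;> simp [Complex.im_sum, crossQ_im]

/-- … so its real part, read back on ℂ, is itself. [folklore] -/
theorem wilsonQ_re_coe (μ ν : Fin d) (x : Pt d) : (((wilsonQ μ ν x).re : ℝ) : ℂ) = wilsonQ μ ν x :=
  Complex.ext (by simp) (by simp [wilsonQ_im])

/-- **(1.22), right member, for the toy kernel**: `Σ_x c·Q_{νμ}(x) x_μ x_ν = c` for μ ≠ ν (`B12Rep537.tsum_wilsonQ_mul_coord2`:
the second-order Taylor data of the marginal form are those of δ_{μν}|p|² − p_μp_ν). [cite: Balaban1987RG1, (1.22) p.264 with (5.42) p.297] -/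
theorem secondMoment_toyKernel {μ ν : Fin d} (hμν : μ ≠ ν) (c : ℝ) :
    B12Beta.secondMoment (fun μ ν (x : Fin d → ℤ) => c * (wilsonQ ν μ x).re) μ ν = c := by
  apply Complex.ofReal_injective
  unfold B12Beta.secondMoment
  rw [Complex.ofReal_tsum]
  have e : ∀ x : Fin d → ℤ, (((c * (wilsonQ ν μ x).re) * (x μ : ℝ) * (x ν : ℝ) : ℝ) : ℂ) =
      (c : ℂ) * (wilsonQ ν μ x * ((x μ : ℂ) * (x ν : ℂ))) := by
    intro x; push_cast; rw [wilsonQ_re_coe]; ring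
  simp_rw [e]
  rw [tsum_mul_left, tsum_wilsonQ_mul_coord2]
  simp [kron, hμν, hμν.symm]

/-- **(5.10) for the toy kernel**: `|c·Q_{νμ}(x)| ≤ |c|·MQ(1, d)·e^{−|x|₁}` (`B12Rep537.wilsonQ_bound`: finite support). [cite: Balaban1987RG1, (5.10) p.293] -/
theorem decay510_toyKernel (c : ℝ) (μ ν : Fin d) :
    B12Sec2to5.Decay510 (fun x : Fin d → ℤ => c * (wilsonQ ν μ x).re) (|c| * MQ 1 d) 1 := by
  intro x
  have hQ := wilsonQ_bound (d := d) one_pos ν μ x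
  have hre : |(wilsonQ ν μ x).re| ≤ ‖wilsonQ ν μ x‖ := Complex.abs_re_le_norm _
  rw [abs_mul, mul_assoc]
  exact mul_le_mul_of_nonneg_left (hre.trans hQ) (abs_nonneg c)

/-- **(1.22), left member, for the toy kernel**: `−∂²∕∂p_μ∂p_ν (c·Q_{νμ})~(0) = c` for μ ≠ ν — the two differentiations under the
lattice sum licensed by (5.10) (`BJ86EffectiveAction.neg_mixedDeriv0_fourierT_eq_secondMoment` with the summabilities of
`EriceZetaUniformBound`). [cite: Balaban1987RG1, (1.22) p.264] -/
theorem fourier_toyKernel {μ ν : Fin d} (hμν : μ ≠ ν) (c : ℝ) :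
    -mixedDeriv0 (fourierT (fun x : Fin d → ℤ => c * (wilsonQ ν μ x).re)) μ ν = (c : ℂ) := by
  have hdec := decay510_toyKernel c μ ν
  have h := neg_mixedDeriv0_fourierT_eq_secondMoment (fun μ ν (x : Fin d → ℤ) => c * (wilsonQ ν μ x).re) μ ν
    (summable_abs_of_decay510 one_pos hdec) (summable_abs_mul_coord_of_decay510 one_pos hdec ν)
    (summable_abs_mul_coord_coord_of_decay510 one_pos hdec μ ν)
  rw [secondMoment_toyKernel hμν c] at h
  exact h

/-- The toy kernel obeys the REFLECTION clause of `d121` AS TYPED (because it is built on the TRANSPOSED marginal kernel —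
`wilsonQ_transpose_reflect`). [cite: Balaban1987RG1, (5.7) p.293] -/
theorem reflect_toyKernel (c : ℝ) {ε : Fin d → ℤ} (hε : ∀ κ, ε κ = 1 ∨ ε κ = -1) (μ ν : Fin d) (z : Pt d) :
    c * (wilsonQ ν μ (fun κ => ε κ * z κ - (if κ = μ then (1 - ε μ) / 2 else 0) +
        (if κ = ν then (1 - ε ν) / 2 else 0))).re = (ε μ : ℝ) * (ε ν : ℝ) * (c * (wilsonQ ν μ z).re) := by
  rw [wilsonQ_transpose_reflect μ ν hε z]
  have e : (((ε μ * ε ν : ℤ) : ℂ)) = (((ε μ : ℝ) * (ε ν : ℝ) : ℝ) : ℂ) := by push_cast; ring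
  rw [e, Complex.re_ofReal_mul]
  ring

/-! ## §3 The representation (5.37)∕(5.38) for the toy kernel: the antisymmetric part as two third-order words -/

/-- The typed difference operators are linear: scalars pass through `diffOp`. [folklore] -/
theorem diffOp_smul (a : Fin d × Bool) (c : ℂ) (g : Pt d → ℂ) :
    diffOp a (fun y => c * g y) = fun x => c * diffOp a g x := by
  funext x; unfold diffOp; cases a.2 <;> simp [delta, B12Rep537.fdelta, mul_sub]

/-- … and through `diffWord`. [folklore] -/
theorem diffWord_smul (w : Fin 3 → Fin d × Bool) (c : ℂ) (g : Pt d → ℂ) (x : Pt d) :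
    diffWord w (fun y => c * g y) x = c * diffWord w g x := by
  unfold diffWord
  rw [diffOp_smul, diffOp_smul, diffOp_smul]

/-- `diffWord` of the zero kernel vanishes. [folklore] -/
theorem diffWord_zero (w : Fin 3 → Fin d × Bool) (x : Pt d) : diffWord w (fun _ : Pt d => (0 : ℂ)) x = 0 := by
  simpa only [zero_mul] using diffWord_smul w 0 (fun _ => (0 : ℂ)) x

/-- The word `(Δ*_μ, Δ_ν, Δ*_ν)` of the typed alphabet acts as `Δ*_μ(Δ_ν(Δ*_ν ·))`. [folklore] -/
theorem diffWord_word (μ ν : Fin d) (g : Pt d → ℂ) (x : Pt d) :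
    diffWord ![(μ, true), (ν, false), (ν, true)] g x = delta μ (fdelta ν (delta ν g)) x := rfl

/-- **(5.37)∕(5.38) FOR THE TOY KERNEL, μ ≠ ν**: `c·Q_{νμ}(x) − c·wilsonQ μ ν x = Σ_w D_w Π′_w(x)` with Π′ supported on the two words
`(Δ*_μ, Δ_ν, Δ*_ν) ↦ −c·δ₀`, `(Δ*_ν, Δ_μ, Δ*_μ) ↦ +c·δ₀` (PART 1 `crossQ_sub_transpose`), each `Π′_w` exponentially bounded at any rate
with constant |c|. [cite: Balaban1987RG1, (5.37)–(5.38) p.297] -/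
theorem rep537_toyKernel {μ ν : Fin d} (hμν : μ ≠ ν) (c : ℝ) (a : ℝ) :
    ∃ rem : (Fin 3 → Fin d × Bool) → Pt d → ℂ,
      (∀ x : Pt d, (((c * (wilsonQ ν μ x).re : ℝ)) : ℂ) - (c : ℂ) * wilsonQ μ ν x = ∑ w, diffWord w (rem w) x) ∧
      ∀ w, ExpBound a |c| (rem w) := by
  classical
  have hne : (![(μ, true), (ν, false), (ν, true)] : Fin 3 → Fin d × Bool) ≠ ![(ν, true), (μ, false), (μ, true)] := by
    intro h
    have h0 := congrFun h 0
    simp only [Matrix.cons_val_zero, Prod.mk.injEq] at h0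
    exact hμν h0.1
  have hδ : ExpBound a 1 (dirac : Pt d → ℂ) := expBound_dirac a
  refine ⟨fun w y => if w = ![(μ, true), (ν, false), (ν, true)] then -(c : ℂ) * dirac y
      else if w = ![(ν, true), (μ, false), (μ, true)] then (c : ℂ) * dirac y else 0, fun x => ?_, fun w => ?_⟩
  · rw [Finset.sum_eq_add (![(μ, true), (ν, false), (ν, true)] : Fin 3 → Fin d × Bool)
      ![(ν, true), (μ, false), (μ, true)] hne
      (fun w _ hw => by simp only [if_neg hw.1, if_neg hw.2]; exact diffWord_zero w x) (by simp) (by simp)]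
    simp only [if_neg hne.symm, if_true]
    rw [diffWord_smul, diffWord_smul, diffWord_word, diffWord_word]
    push_cast
    rw [wilsonQ_re_coe, ← mul_sub, wilsonQ_transpose_sub, crossQ_sub_transpose]
    ring
  · intro y
    by_cases h1 : w = ![(μ, true), (ν, false), (ν, true)]
    · simp only [h1, if_true]
      have := hδ y
      rw [norm_mul, norm_neg, Complex.norm_real, Real.norm_eq_abs]
      nlinarith [abs_nonneg c]
    · by_cases h2 : w = ![(ν, true), (μ, false), (μ, true)]
      · simp only [h2, if_neg hne.symm, if_true]
        have := hδ y
        rw [norm_mul, Complex.norm_real, Real.norm_eq_abs]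
        nlinarith [abs_nonneg c]
      · simp only [if_neg h1, if_neg h2, norm_zero]
        have := hδ y
        nlinarith [abs_nonneg c, norm_nonneg (dirac y)]

/-! ## §4 THE AF TOY: the interface is consistent with asymptotic freedom and with Theorem 2 -/

/-- The toy's coupling table: the FORWARD solution of (0.20) from the bare coupling g₀ with a last-variable β-function `F k g_k`
(`Nat.rec`, def-free): g_{k+1} = (1∕g_k² − F k g_k)^{−1∕2} (junk 0 once the run breaks off). [cite: Balaban1987RG1, (0.20) p.256] -/
theorem natRec_run_succ (g₀ : ℝ) (F : ℕ → ℝ → ℝ) (k : ℕ) :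
    (Nat.rec (motive := fun _ => ℝ) g₀ (fun k g => 1 / Real.sqrt (1 / g ^ 2 - F k g)) (k + 1) : ℝ) =
      1 / Real.sqrt (1 / (Nat.rec (motive := fun _ => ℝ) g₀ (fun k g => 1 / Real.sqrt (1 / g ^ 2 - F k g)) k : ℝ) ^ 2 -
        F k (Nat.rec (motive := fun _ => ℝ) g₀ (fun k g => 1 / Real.sqrt (1 / g ^ 2 - F k g)) k : ℝ)) :=
  rfl

/-- One forward step of the toy run IS the printed forward determination `d020`: if 1∕g_k² − F k g_k > 0 then g_{k+1} > 0 and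
1∕g_k² = 1∕g_{k+1}² + F k g_k. [cite: Balaban1987RG1, (0.20) p.256] -/
theorem natRec_run_step (g₀ : ℝ) (F : ℕ → ℝ → ℝ) (k : ℕ)
    (h : 0 < 1 / (Nat.rec (motive := fun _ => ℝ) g₀ (fun k g => 1 / Real.sqrt (1 / g ^ 2 - F k g)) k : ℝ) ^ 2 -
      F k (Nat.rec (motive := fun _ => ℝ) g₀ (fun k g => 1 / Real.sqrt (1 / g ^ 2 - F k g)) k : ℝ)) :
    0 < (Nat.rec (motive := fun _ => ℝ) g₀ (fun k g => 1 / Real.sqrt (1 / g ^ 2 - F k g)) (k + 1) : ℝ) ∧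
      1 / (Nat.rec (motive := fun _ => ℝ) g₀ (fun k g => 1 / Real.sqrt (1 / g ^ 2 - F k g)) k : ℝ) ^ 2 =
        1 / (Nat.rec (motive := fun _ => ℝ) g₀ (fun k g => 1 / Real.sqrt (1 / g ^ 2 - F k g)) (k + 1) : ℝ) ^ 2 +
          F k (Nat.rec (motive := fun _ => ℝ) g₀ (fun k g => 1 / Real.sqrt (1 / g ^ 2 - F k g)) k : ℝ) := by
  rw [natRec_run_succ]
  generalize (Nat.rec (motive := fun _ => ℝ) g₀ (fun k g => 1 / Real.sqrt (1 / g ^ 2 - F k g)) k : ℝ) = g at h ⊢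
  refine ⟨one_div_pos.mpr (Real.sqrt_pos.mpr h), ?_⟩
  rw [div_pow, one_pow, Real.sq_sqrt h.le, one_div_one_div]
  ring

/-- **THE AF TOY**: L = 13; β_{j+1} ≡ b := 1∕100 (asymptotic freedom, one loop, no interaction); the kernels
Π_{j+1,μν} := b·Re Q_{νμ} (the TRANSPOSED marginal kernel — PART 1's orientation); pol F := F(1)·b·Re Qᵀ with log Z ≡ 1, 𝐄_int ≡ 0;
(1.18)'s representation slot := «|F(1)| ≤ E»; runs = the forward solutions of (0.20).  It satisfies `StandingHypotheses ∧ Definitions ∧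
Conclusions` ((1.22) both members: `fourier_toyKernel`, `secondMoment_toyKernel`; (5.6)–(5.8): `wilsonQ_perm`, `reflect_toyKernel`,
`wilsonQ_neg_transpose`; (5.10): `decay510_toyKernel`; (5.37)∕(5.38) with (5.44): `rep537_toyKernel`) and Theorem 3's run
hypothesis for the genuine run (K, m, g₀) = (1, 0, 1∕2). [folklore] -/
theorem afToy_exists : ∃ S : Setting, (∀ j p, S.β j p = 1 / 100) ∧ S.γ = 1 ∧
    StandingHypotheses S ∧ Definitions S ∧ Conclusions S ∧ RunHyp S ⟨1, 0, 1 / 2⟩ := by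
  -- `Setting` fields in the order listed at `zeroToy_exists`.
  refine ⟨⟨13, True, 1,
      fun P k => Nat.rec (motive := fun _ => ℝ) P.g0 (fun k g => 1 / Real.sqrt (1 / g ^ 2 - (fun (_ : ℕ) (_ : ℝ) => (1 / 100 : ℝ)) k g)) k,
      fun _ _ => 1 / 100, 1, 1, 1, fun _ => Unit, fun _ => (), fun _ _ => 1, fun _ _ _ => 0, fun _ _ _ => 1,
      fun _ F E => |F ()| ≤ E, 1, 1, 1, fun _ => 1,
      fun _ F => fun μ ν x => F () * ((1 / 100 : ℝ) * (wilsonQ ν μ x).re),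
      fun _ _ => fun μ ν x => (1 / 100 : ℝ) * (wilsonQ ν μ x).re, 1, fun _ _ => True, 1, True, fun _ _ => 0, 1, 1,
      |(1 / 100 : ℝ)| * MQ 1 4, |(1 / 100 : ℝ)|⟩, fun _ _ => rfl, rfl, ?_, ?_, ?_, ?_⟩
  · exact { hL := ⟨by decide, by norm_num⟩, hG := trivial, hκ₀ := by norm_num, hMκ := by norm_num, hγ := by norm_num,
            hε₀ := by norm_num, hε₁ := by norm_num, hα₀ := by norm_num, hα₁ := by norm_num, hκ := by norm_num,
            hM := by norm_num }
  · refine { d018 := fun P => rfl, d020 := ?_, d13 := ?_, d213 := ?_, d214 := ?_, d120 := ?_, d120split := ?_,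
             d121 := ?_, d122 := ?_ }
    · intro P k _ _ hrhs; exact natRec_run_step P.g0 (fun _ _ => (1 / 100 : ℝ)) k hrhs
    · intro j p U; simp
    · intro k p p' _ _; rfl
    · intro k p; rfl
    · intro j p; funext μ ν x; simp
    · intro j p; funext μ ν x; simp
    · intro j p
      refine ⟨fun σ μ ν x => ?_, fun ε hε μ ν z => reflect_toyKernel (1 / 100) hε μ ν z, fun μ ν z => ?_⟩
      · show (1 / 100 : ℝ) * (wilsonQ (σ ν) (σ μ) (x ∘ σ.symm)).re = (1 / 100 : ℝ) * (wilsonQ ν μ x).re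
        rw [wilsonQ_perm]
      · show (1 / 100 : ℝ) * (wilsonQ ν μ z).re = (1 / 100 : ℝ) * (wilsonQ μ ν (-z)).re
        rw [wilsonQ_neg_transpose ν μ z]
    · intro j p _ μ ν hμν
      exact ⟨(fourier_toyKernel hμν (1 / 100)).symm, (secondMoment_toyKernel hμν (1 / 100)).symm⟩
  · refine { c13 := fun _ _ _ _ => trivial, c118 := fun _ _ _ _ _ _ => ⟨?_, ?_⟩, c264 := ?_, c510 := ?_, c537 := ?_ }
    · show |(1 : ℝ)| ≤ 1; simp
    · show |(0 : ℝ)| ≤ 1; simp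
    · intro P _ j _
      refine ⟨fun n => ?_, fun _ => ?_, fun n => ⟨1 / 100, fun s _ => ?_⟩⟩
      · show ContDiffOn ℝ n (fun _ : ℝ => (1 / 100 : ℝ)) _; exact contDiffOn_const
      · show AnalyticOn ℝ (fun _ : ℝ => (1 / 100 : ℝ)) _; exact analyticOn_const
      · show ‖iteratedDerivWithin n (fun _ : ℝ => (1 / 100 : ℝ)) _ s‖ ≤ 1 / 100
        rw [iteratedDerivWithin_const]; split_ifs <;> simp
    · refine ⟨by norm_num, fun j F E hF μ ν x => ?_⟩
      have hF' : |F ()| ≤ E := hF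
      have hd := decay510_toyKernel (d := 4) (1 / 100) μ ν x
      show |F () * ((1 / 100 : ℝ) * (wilsonQ ν μ x).re)| ≤ |(1 / 100 : ℝ)| * MQ 1 4 * E * Real.exp (-1 * B12Sec2to5.l1 x)
      calc |F () * ((1 / 100 : ℝ) * (wilsonQ ν μ x).re)| = |F ()| * |(1 / 100 : ℝ) * (wilsonQ ν μ x).re| := abs_mul _ _
        _ ≤ E * (|(1 / 100 : ℝ)| * MQ 1 4 * Real.exp (-1 * B12Sec2to5.l1 x)) :=
            mul_le_mul hF' hd (abs_nonneg _) ((abs_nonneg _).trans hF')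
        _ = |(1 / 100 : ℝ)| * MQ 1 4 * E * Real.exp (-1 * B12Sec2to5.l1 x) := by ring
    · intro P _ j _ s _ μ ν
      by_cases hμν : μ = ν
      · subst hμν
        refine ⟨fun _ _ => 0, fun x => ?_, fun w y => ?_⟩
        · show ((((1 / 100 : ℝ) * (wilsonQ μ μ x).re : ℝ)) : ℂ) - (((1 / 100 : ℝ)) : ℂ) * wilsonQ μ μ x =
            ∑ w, diffWord w (fun _ : Pt 4 => (0 : ℂ)) x
          simp only [diffWord_zero, Finset.sum_const_zero]
          push_cast
          rw [wilsonQ_re_coe, sub_self]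
        · show ‖(0 : ℂ)‖ ≤ |(1 / 100 : ℝ)| * 1 * wt (1 / 2) y
          rw [norm_zero]; exact mul_nonneg (by norm_num) (le_of_lt (wt_pos _ _))
      · obtain ⟨rem, hrep, hdec⟩ := rep537_toyKernel (d := 4) hμν (1 / 100) (1 / 2)
        exact ⟨rem, hrep, fun w => (hdec w).mono (by simp)⟩
  · refine ⟨fun k hk => ?_, fun k hk => ?_⟩
    · obtain rfl : k = 0 := Nat.lt_one_iff.mp hk
      exact (natRec_run_step (1 / 2) (fun _ _ => (1 / 100 : ℝ)) 0 (by show (0 : ℝ) < 1 / (1 / 2) ^ 2 - 1 / 100; norm_num)).2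
    · interval_cases k
      · exact ⟨by show (0 : ℝ) < 1 / 2; norm_num, by show (1 / 2 : ℝ) ≤ 1; norm_num⟩
      · have h1 : (1 : ℝ) ≤ Real.sqrt (1 / (1 / 2) ^ 2 - 1 / 100) := Real.one_le_sqrt.mpr (by norm_num)
        have hpos : 0 < Real.sqrt (1 / (1 / 2 : ℝ) ^ 2 - 1 / 100) := lt_of_lt_of_le one_pos h1
        show 0 < 1 / Real.sqrt (1 / (1 / 2 : ℝ) ^ 2 - 1 / 100) ∧ 1 / Real.sqrt (1 / (1 / 2 : ℝ) ^ 2 - 1 / 100) ≤ 1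
        exact ⟨by positivity, (div_le_one hpos).mpr h1⟩

/-- **[I] AS PRINTED IS CONSISTENT WITH THEOREM 2 AND WITH ASYMPTOTIC FREEDOM** (orientation certificate): there is a setting
satisfying p. 251's ∕ Theorem 3's standing hypotheses, the printed `Definitions` and Theorem 3's printed `Conclusions` — hence
`B12BetaAsPrinted S` — whose β-functions are a POSITIVE constant b on every history (so `BetaLowerH b`, `BetaUpperH b`, joint
continuity on the boxes hold), which has a genuine run satisfying Theorem 3's run hypothesis with K ≥ 1 (so the run-level
conclusions `c118 ∕ c264 ∕ c537` are exercised, at a step where β ≠ 0), and for which `Theorem2Statement S hL` HOLDS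
(`EriceFlowEnclosureB12AsPrintedUpper.theorem2Statement_of_letters`).  In particular no sign convention of the typed interface clashes
with β > 0 (contrast: the Erice interface's orientation note, `beta/asprinted/DELTA.md` D-23), and the typed pair (`d121`, `c537`)
is jointly satisfiable with β ≠ 0 (the orientation mismatch of PART 2 is NOT an inconsistency). [cite: Balaban1987RG1, Thm 2 p.259 with Thm 3 p.264 and (5.37) p.297] -/
theorem asPrinted_consistent_with_theorem2_and_AF :
    ∃ S : Setting, ∃ hH : StandingHypotheses S, Definitions S ∧ Conclusions S ∧ B12BetaAsPrinted S ∧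
      (∃ b : ℝ, 0 < b ∧ (∀ j p, S.β j p = b) ∧ BetaLowerH b S.γ S.β ∧ BetaUpperH b S.γ S.β ∧ BetaContH S.γ S.β) ∧
      (∃ P : B12.RunParams, RunHyp S P ∧ 1 ≤ P.K) ∧ Theorem2Statement S (hL_of_standing hH) := by
  obtain ⟨S, hβ, hγ, hH, hD, hC, hR⟩ := afToy_exists
  have hlo : BetaLowerH (1 / 100) S.γ S.β := fun k v _ => by rw [hβ]
  have hup : BetaUpperH (1 / 100) S.γ S.β := fun k v _ => by rw [hβ]
  have hcont : BetaContH S.γ S.β := fun k => by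
    have e : S.β k = fun _ => 1 / 100 := funext (hβ k)
    rw [e]; exact continuousOn_const
  have hγpos : 0 < S.γ := by rw [hγ]; norm_num
  exact ⟨S, hH, hD, hC, fun _ _ => hC, ⟨1 / 100, by norm_num, hβ, hlo, hup, hcont⟩, ⟨⟨1, 0, 1 / 2⟩, hR, le_rfl⟩,
    theorem2Statement_of_letters hH hD hγpos (by norm_num) le_rfl hcont hlo hup⟩

/-- **THEOREM 2 IS INDEPENDENT OF [I]'S PRINTED CONTENT, AS TYPED.**  Neither `∀ S, StandingHypotheses → Definitions → Conclusions →
Theorem2Statement` nor `… → ¬Theorem2Statement` holds: the AF toy satisfies the antecedents with Theorem 2, the zero toy satisfies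
them without.  (What [I]+[II] prove — Theorem 3 with (5.10), (5.37)–(5.44) — is compatible with, and does not decide, the
Theorem 2 that [I] states without proof; its proof is the NOT-IN-PRINT half of the β binder: BetaPertH ⇐ (D1) ∧ (D4) ∧ CAP+tail.)
[cite: Balaban1987RG1, Thm 2 p.259 («A proof … will be given in a separate paper»); Balaban1989LargeFieldII, p.355] -/
theorem theorem2_independent_of_asPrinted :
    (¬ ∀ (S : Setting) (hH : StandingHypotheses S), Definitions S → Conclusions S →
        Theorem2Statement S (hL_of_standing hH)) ∧
    (¬ ∀ (S : Setting) (hH : StandingHypotheses S), Definitions S → Conclusions S →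
        ¬ Theorem2Statement S (hL_of_standing hH)) := by
  constructor
  · intro h
    obtain ⟨S, hH, hD, hC, -, hnot⟩ := asPrinted_consistent_with_not_theorem2
    exact hnot (h S hH hD hC)
  · intro h
    obtain ⟨S, hH, hD, hC, -, -, -, hT⟩ := asPrinted_consistent_with_theorem2_and_AF
    exact h S hH hD hC hT

end

end Summit.QuantumFields.BalabanUV.Beta.EriceFlowEnclosureB12AsPrintedWitness
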